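import Summits.BirchSwinnertonDyer.BirchSwinnertonDyer.Theorems.GenusKolyvaginAtTwoPowDvdShaCardAtTwoRTRelaxedRung
import Summits.BirchSwinnertonDyer.BirchSwinnertonDyer.Theorems.GenusKolyvaginAtTwoVisiblePairAtTwoHeegnerClassKummer
import Summits.BirchSwinnertonDyer.BirchSwinnertonDyer.Theorems.GenusKolyvaginAtTwoVisiblePairAtTwoKolyvaginClassSign
import Literature.NumberTheory.EllipticCurves.McCallum1991.DivisibilityDescent
import Literature.NumberTheory.EllipticCurves.TianYuanZhang2017.GenusDescentEnSide
import HarnessLib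

/-!
# Route `GenusKolyvaginAtTwo`, LINE 18 (L_T `PowDvdShaCardAtTwoRT`, stmt-BirchSwinnertonDyer-23242), stub L
# `stub_twinShaLaddersAtTwo` — THE FRAME BINDERS of `twinShaLadders_of_Kside_supplies(_swapped)` FROM L_T's OWN BINDERS

Seat `bsd-line-gk2-p2` g18 (PROVER seat 2/3, cell `bsd-f1-sign2`), `--supports stmt-BirchSwinnertonDyer-23242` (helper; closes
nothing). THEOREMS ONLY (no definition, no named fact, no `sorry`); BSD is not proved by any of this.

WHAT. The descent layer (`…RTTwinShaLaddersOfSupplies`, `…RTRungDescentVariants`, memo `Lines/plus-descent-descent-layer.md`) takes a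
frame at level `2^L` over `K`: `E(K)[2^L] = 0`, `2^L`-divisibility of `E(K̄)`, a point `g` generating `E(K)` modulo `2^L`, the bottom point
`P₀ = y_K ∈ E(K)` with `2^L ∤ P₀`, and (for the suppliers' seed) `δ(P₀) = c_L(1)`. This file derives all of them from L_T's displayed
binders (`ρ̄_{E,2}` onto, `d_K` odd, Heegner, the exactness clause `¬ 2^{M₀+1} ∣ P(1)` in `E(K[1])`) plus `rank E(K) ≤ 1` (Kolyvagin's
theorem, the `.kolyvagin` conjunct of `PubInputsAtTwo`):

* §1 `odd_addOrderOf_of_forall_two_smul_eq_zero`, **`exists_generator_mod_two_pow`** — over any number field: `rank ≤ 1` and no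
  rational `2`-torsion ⟹ some `g` generates `E(F)` modulo `2^L` (`TianYuanZhang2017.exists_generator_mod_torsion` + odd torsion is
  `2^L`-divisible, `exists_zsmul_two_pow_eq_of_odd_addOrderOf`).
* §2 **`forall_two_pow_smul_ne_bottom_of_not_dvd_derivedPoint`** — `P₀ ↦ P(1)` and `¬ 2^{M₀+1} ∣ P(1)` in `E(K[1])`, `M₀ < L` ⟹ `2^L ∤ P₀` in `E(K)`.
* §3 **`kummerMapTorsion_bottom_mem_selmerGroup_and_conjAct`** — the seed `δ(P₀) = c_L(1)` is a SELMER class of sign `−w(E)` (so it is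
  a legitimate member of McCallum's `C ⊆ Sel^{ε_r}` at the depths `r` of sign `−w(E)`): Kummer classes are Selmer
  (`kummerMapTorsion_mem_selmerLocalKer`), `c_L(1) = δ(P₀)` (gk2 `VisiblePairAtTwo.kolyvaginClass_one_two_eq_kummerMapTorsion`), sign by
  `KolyvaginClassSign.sign_conjAct_kolyvaginClass_two` at `n = 1`.
* §4 **`exists_Kside_frame`** — all binders at once from L_T's: `E(K)[2^L] = 0`
  (`EigenClassesFinite.forall_zsmul_two_pow_baseChange_eq_zero_of_hasSurjectiveModNGaloisRep_two`), `g`, `P₀`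
  (`McCallum1991.exists_map_eq_derivedPoint_one'`), `2^L ∤ P₀`, `c_L(1) = δ(P₀)`.
The remaining frame binder of the rank-`0` side (`W(ℚ)` resp. `Wd(ℚ)` `2^L`-divisible) is gk2-p1's
`exists_zsmul_two_pow_eq_of_rank_zero_of_odd_torsionOrder` (rank `0` + odd torsion order), not repeated here.

References: [McCallumLMS1991] §5 p. 285 (top: `E(K)/p^M ↪ E(K_1)/p^M`), Lemma 5.1; [GrossLMS1991] §1, §4 (4.1), (4.4);
[SilvermanAEC2009] VIII.§2, X.4.2.
-/

set_option autoImplicit false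
-- the Theorems namespace of this sub repeats the summit name by design (D-0017 nested layout)
set_option linter.dupNamespace false

noncomputable section

open scoped Classical

namespace Summit.BirchSwinnertonDyer.BirchSwinnertonDyer.Theorems.GenusExact.PlusDescent

open WeierstrassCurve NumberField IsDedekindDomain Field Literature.NumberTheory.EllipticCurves
  Literature.NumberTheory.GaloisRepresentations Literature.NumberTheory.EllipticCurves.ModularForms AddSubgroup

/-! ## §1 A generator of `E(F)` modulo `2^L` -/

section Generator

variable {F : Type} [Field F] [NumberField F] (V : WeierstrassCurve F) [V.IsElliptic]

omit [NumberField F] [V.IsElliptic] in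
/-- Without rational `2`-torsion every torsion point has odd order. [folklore] -/
theorem odd_addOrderOf_of_forall_two_smul_eq_zero (h2 : ∀ P : V.toAffine.Point, (2 : ℤ) • P = 0 → P = 0)
    {t : V.toAffine.Point} (ht : IsOfFinAddOrder t) : Odd (addOrderOf t) := by
  by_contra hodd
  obtain ⟨m, hm⟩ := Nat.not_odd_iff_even.mp hodd
  have hpos : 0 < addOrderOf t := ht.addOrderOf_pos
  have hm0 : 0 < m := by omega
  have hkill : (2 : ℤ) • (m • t) = 0 := by
    rw [two_zsmul, ← add_nsmul, ← hm]
    exact addOrderOf_nsmul_eq_zero t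
  have hmt : m • t = 0 := h2 _ hkill
  have hdvd : addOrderOf t ∣ m := addOrderOf_dvd_iff_nsmul_eq_zero.mpr hmt
  have := Nat.le_of_dvd hm0 hdvd
  omega

/-- **`rank E(F) ≤ 1` and `E(F)[2] = 0` ⟹ some `g ∈ E(F)` generates `E(F)` modulo `2^L`**: `E(F) = ℤg ⊕ T` with `#T` odd, and odd
torsion is `2^L`-divisible. (For `E_K` on L_T's frame: rank `1` by Kolyvagin, no `2`-torsion by `ρ̄_{E,2}` onto.)
[cite: SilvermanAEC2009, VIII.§2] [cite: GrossLMS1991, §1] -/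
theorem exists_generator_mod_two_pow (hr : V.mordellWeilRank ≤ 1)
    (h2 : ∀ P : V.toAffine.Point, (2 : ℤ) • P = 0 → P = 0) (L : ℕ) :
    ∃ g : V.toAffine.Point, ∀ P : V.toAffine.Point, ∃ (k : ℤ) (Q : V.toAffine.Point), ((2 ^ L : ℕ) : ℤ) • Q = P - k • g := by
  obtain ⟨g, hg⟩ := TianYuanZhang2017.W2.exists_generator_mod_torsion V hr
  refine ⟨g, fun P ↦ ?_⟩
  obtain ⟨k, hk⟩ := hg P
  obtain ⟨Q, hQ⟩ := exists_zsmul_two_pow_eq_of_odd_addOrderOf V L (odd_addOrderOf_of_forall_two_smul_eq_zero V h2 hk)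
  exact ⟨k, Q, hQ⟩

end Generator

/-! ## §2 `2^L ∤ P₀` in `E(K)` from `¬ 2^{M₀+1} ∣ P(1)` in `E(K[1])` -/

section Bottom

variable {K : Type} [Field K] [NumberField K] {W : WeierstrassCurve ℚ} {N : ℕ} [NeZero N]
  {Dt : ModularParametrizationData W N} {β : ℤ} {ι : K →+* ℂ}

/-- **`2^L ∤ P₀` in `E(K)`** when `P₀ ↦ P(1)` along `E(K) → E(K[1])`, `2^{M₀+1} ∤ P(1)` in `E(K[1])` and `M₀ < L` (the easy half of
McCallum's remark `E(K)/p^M E(K) ↪ E(K_1)/p^M E(K_1)`: a `2^L`-th root in `E(K)` maps to a `2^{M₀+1}`-th root in `E(K[1])`).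
[cite: McCallumLMS1991, §5 p. 285] -/
theorem forall_two_pow_smul_ne_bottom_of_not_dvd_derivedPoint (d₁ : KolyvaginHeegnerData Dt β ι 1)
    (P₀ : (W.baseChange K).toAffine.Point)
    (hP₀ : WeierstrassCurve.Affine.Point.map (W' := W) (algebraMap K (ringClassField K ι 1)).toRatAlgHom P₀ = d₁.derivedPoint)
    {M₀ L : ℕ} (hML : M₀ + 1 ≤ L)
    (hndiv : ¬ ∃ Q : (W.baseChange (ringClassField K ι 1)).toAffine.Point, ((2 ^ (M₀ + 1) : ℕ) : ℤ) • Q = d₁.derivedPoint) :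
    ∀ Q : (W.baseChange K).toAffine.Point, ((2 ^ L : ℕ) : ℤ) • Q ≠ P₀ := by
  intro Q hQ
  apply hndiv
  obtain ⟨e, he⟩ := Nat.exists_eq_add_of_le hML
  refine ⟨((2 ^ e : ℕ) : ℤ) • WeierstrassCurve.Affine.Point.map (W' := W) (algebraMap K (ringClassField K ι 1)).toRatAlgHom Q, ?_⟩
  rw [← hP₀, ← hQ, map_zsmul, smul_smul, ← Nat.cast_mul, ← pow_add, he]

end Bottom

/-! ## §3 The seed `δ(P₀) = c_L(1)` is a Selmer class of sign `−w(E)` -/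

section Seed

variable {K : Type} [Field K] [NumberField K] (W : WeierstrassCurve ℚ) [W.IsElliptic] [W.IsGloballyMinimal]
  [NeZero (W.conductorNorm ℤ)] {Dt : ModularParametrizationData W (W.conductorNorm ℤ)} {β : ℤ} {ι : K →+* ℂ}

/-- **The seed of the Mordell–Weil side is a legitimate member of McCallum's `C`**: on L_T's habitat, for the descended bottom point
`P₀ ↦ P(1)`, the Kummer class `δ_{2^L}(P₀)` is SELMER, equals `c_L(1)`, and `τ δ(P₀) = −w(E) • δ(P₀)`.
[cite: GrossLMS1991, §4 (4.4), §5 Prop. 5.4] [cite: McCallumLMS1991, §5 Prop. 5.2] [cite: SilvermanAEC2009, X.4.2] -/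
theorem kummerMapTorsion_bottom_mem_selmerGroup_and_conjAct (hK : IsImaginaryQuadratic K) (hne3 : NumberField.discr K ≠ -3)
    (hne4 : NumberField.discr K ≠ -4) (hodd : Odd (NumberField.discr K)) (hH : SatisfiesHeegnerHypothesis (W.conductorNorm ℤ) K)
    (hsurj : W.HasSurjectiveModNGaloisRep ((2 : ℤ) ^ 1)) (τ : K ≃ₐ[ℚ] K) (hτ : τ ≠ 1) {L : ℕ} (hL : 1 ≤ L)
    (hdiv : ∀ P : geomPoints (W.baseChange K), ∃ Q : geomPoints (W.baseChange K), ((2 ^ L : ℕ) : ℤ) • Q = P)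
    (d₁ : KolyvaginHeegnerData Dt β ι 1) (P₀ : (W.baseChange K).toAffine.Point)
    (hP₀ : WeierstrassCurve.Affine.Point.map (W' := W) (algebraMap K (ringClassField K ι 1)).toRatAlgHom P₀ = d₁.derivedPoint) :
    kummerMapTorsion (W.baseChange K) ((2 ^ L : ℕ) : ℤ) hdiv P₀ ∈ selmerGroup (W.baseChange K) ((2 ^ L : ℕ) : ℤ) ∧
      d₁.kolyvaginClass Nat.prime_two L = kummerMapTorsion (W.baseChange K) ((2 ^ L : ℕ) : ℤ) hdiv P₀ ∧
      conjAct W τ ((2 ^ L : ℕ) : ℤ) (kummerMapTorsion (W.baseChange K) ((2 ^ L : ℕ) : ℤ) hdiv P₀) =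
        (-W.rootNumber) • kummerMapTorsion (W.baseChange K) ((2 ^ L : ℕ) : ℤ) hdiv P₀ := by
  have hsel : kummerMapTorsion (W.baseChange K) ((2 ^ L : ℕ) : ℤ) hdiv P₀ ∈ selmerGroup (W.baseChange K) ((2 ^ L : ℕ) : ℤ) :=
    (mem_selmerGroup_iff _ _ _).mpr ⟨fun v ↦ kummerMapTorsion_mem_selmerLocalKer _ _ hdiv _ P₀,
      fun w ↦ kummerMapTorsion_mem_selmerLocalKer _ _ hdiv _ P₀⟩
  have heq : d₁.kolyvaginClass Nat.prime_two L = kummerMapTorsion (W.baseChange K) ((2 ^ L : ℕ) : ℤ) hdiv P₀ :=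
    VisiblePairAtTwo.kolyvaginClass_one_two_eq_kummerMapTorsion W K hK hodd hH hsurj L d₁ P₀ hP₀
  refine ⟨hsel, heq, ?_⟩
  have hsign := (KolyvaginClassSign.sign_conjAct_kolyvaginClass_two hK hne3 hne4 hodd hH hsurj τ hτ Dt β ι
    squarefree_one hL (fun ℓ hℓ ↦ absurd hℓ (by simp)) d₁).2
  rw [heq] at hsign
  simpa using hsign

end Seed

/-! ## §4 All frame binders at once from L_T's -/

section Frame

variable {K : Type} [Field K] [NumberField K] (W : WeierstrassCurve ℚ) [W.IsElliptic] [W.IsGloballyMinimal]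
  [NeZero (W.conductorNorm ℤ)] (Dt : ModularParametrizationData W (W.conductorNorm ℤ)) (β : ℤ) (ι : K →+* ℂ)

/-- **THE K-SIDE FRAME OF THE DESCENT LAYER FROM L_T's BINDERS.** On L_T's habitat (`K` imaginary quadratic with odd `d_K`, Heegner,
`ρ̄_{E,2}` onto) with `rank E(K) ≤ 1` (Kolyvagin), a datum `d₁` at level `1`, `M₀ < L` and `¬ 2^{M₀+1} ∣ P(1)` in `E(K[1])`: `E(K)[2^L] = 0`;
there are `g, P₀ ∈ E(K)` with `g` generating `E(K)` modulo `2^L`, `P₀ ↦ P(1)`, `2^L ∤ P₀`, and `c_L(1) = δ(P₀)` — the binders `hL`, `g`/`hg`,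
`P₀`/`hP₀` of `twinShaLadders_of_Kside_supplies(_swapped)` and the identification of their seed with McCallum's `c_L(1)`.
[cite: McCallumLMS1991, §5 p. 285] [cite: GrossLMS1991, §1, §4 (4.1), (4.4)] -/
theorem exists_Kside_frame (hK : IsImaginaryQuadratic K) (hodd : Odd (NumberField.discr K))
    (hH : SatisfiesHeegnerHypothesis (W.conductorNorm ℤ) K) (hsurj : W.HasSurjectiveModNGaloisRep ((2 : ℤ) ^ 1))
    (hrk : (W.baseChange K).mordellWeilRank ≤ 1) (d₁ : KolyvaginHeegnerData Dt β ι 1) {M₀ L : ℕ} (hML : M₀ + 1 ≤ L)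
    (hndiv : ¬ ∃ Q : (W.baseChange (ringClassField K ι 1)).toAffine.Point, ((2 ^ (M₀ + 1) : ℕ) : ℤ) • Q = d₁.derivedPoint)
    (hdiv : ∀ P : geomPoints (W.baseChange K), ∃ Q : geomPoints (W.baseChange K), ((2 ^ L : ℕ) : ℤ) • Q = P) :
    (∀ P : (W.baseChange K).toAffine.Point, ((2 ^ L : ℕ) : ℤ) • P = 0 → P = 0) ∧
      ∃ g P₀ : (W.baseChange K).toAffine.Point,
        (∀ P : (W.baseChange K).toAffine.Point, ∃ (k : ℤ) (Q : (W.baseChange K).toAffine.Point),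
          ((2 ^ L : ℕ) : ℤ) • Q = P - k • g) ∧
        WeierstrassCurve.Affine.Point.map (W' := W) (algebraMap K (ringClassField K ι 1)).toRatAlgHom P₀ = d₁.derivedPoint ∧
        (∀ Q : (W.baseChange K).toAffine.Point, ((2 ^ L : ℕ) : ℤ) • Q ≠ P₀) ∧
        d₁.kolyvaginClass Nat.prime_two L = kummerMapTorsion (W.baseChange K) ((2 ^ L : ℕ) : ℤ) hdiv P₀ := by
  have hs2 : W.HasSurjectiveModNGaloisRep 2 := by simpa using hsurj
  have hL : ∀ M : ℕ, ∀ P : (W.baseChange K).toAffine.Point, ((2 ^ M : ℕ) : ℤ) • P = 0 → P = 0 := fun M ↦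
    EigenClassesFinite.forall_zsmul_two_pow_baseChange_eq_zero_of_hasSurjectiveModNGaloisRep_two W K hK.1 hs2 M
  have h2 : ∀ P : (W.baseChange K).toAffine.Point, (2 : ℤ) • P = 0 → P = 0 := fun P hP ↦ hL 1 P (by simpa using hP)
  obtain ⟨g, hg⟩ := exists_generator_mod_two_pow (W.baseChange K) hrk h2 L
  obtain ⟨P₀, hP₀⟩ := McCallum1991.exists_map_eq_derivedPoint_one' hK d₁
  exact ⟨hL L, g, P₀, hg, hP₀, forall_two_pow_smul_ne_bottom_of_not_dvd_derivedPoint d₁ P₀ hP₀ hML hndiv,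
    VisiblePairAtTwo.kolyvaginClass_one_two_eq_kummerMapTorsion W K hK hodd hH hsurj L d₁ P₀ hP₀⟩

end Frame

end Summit.BirchSwinnertonDyer.BirchSwinnertonDyer.Theorems.GenusExact.PlusDescent

end
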